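import Literature.Geometry.Riemannian.ShrinkerEntropyProofs
import Literature.Geometry.Riemannian.HeatKernelGradientEstimate
import Literature.Geometry.Riemannian.ShrinkerPotentialGrowthProofs
import Literature.Geometry.Riemannian.ShrinkerScalarCurvatureNonnegHolds
import Summits.SmoothPoincare4.SmoothPoincare4.Theorems.EntropyRungNoncompactShrinkerGapStubCompactSupportLSIMixture
import HarnessLib

/-!
# Static entropy decay from a gradient bound (crux `EntropyRung.NoncompactShrinkerGap`,
# stmt-SmoothPoincare4-10868, line `collapsed-ends-usc`, v13): stub `helper_entropyDecay_static`

On a complete connected normalised gradient shrinking Ricci soliton `(Mⁿ, g, f)`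
(`Ric + Hess f = g/2`, `R + |∇f|² = f`, closed balls compact) and for constants `0 < c ≤ C`,
`ε > 0`, there is `δ > 0` — depending only on the soliton, `c` and `ε` — such that every smooth
`ρ` with `c ≤ ρ ≤ C`, `|∇ρ|² ≤ δ` and `∫ ρ e^{-f} = m` has small weighted entropy relative to its
mean: `∫ ρ log ρ e^{-f} − m log (m/Z) ≤ ε`, `Z = ∫ e^{-f}`. This is the last step `H(T) → 0` of the
Bakry–Émery heat-flow proof of the logarithmic Sobolev inequality run on the non-compact soliton;
no spectral gap is used, only the explicit geometry of the shrinker: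

* `R ≥ 0` (Zhang 2009 / Chen 2009; the tree's `Zhang2009.minimumPrinciple_core` fed by
  `Zhang2009.directionalComparison_core`, exactly as in `shrinkerScalarCurvature_nonneg_holds`, here
  for a universe-polymorphic `M`), hence `|∇f|² ≤ f`, a minimum point `p` of `f` and the lower
  growth `¼ (d(p, x) − 5n)₊² ≤ f(x)` (Haslhofer–Müller 2011, Lemma 2.1:
  `HaslhoferMuller.exists_forall_potential_le`, `…potential_lower_of_scalarCurvature_nonneg`), so
  `f` is proper, `e^{-f}` and `f e^{-f}` are integrable (Carrillo–Ni 2009, Thm. 1.1 (i):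
  `integrable_exp_neg_of_proper`) and `d(p, x)² ≤ 8 f(x) + 50 n²` (`toReal_edist_sq_le`);
* the gradient bound is a Lipschitz bound (`ofReal_abs_sub_le_of_gradSq_le`):
  `(ρ(x) − ρ(p))² ≤ δ d(p, x)² ≤ δ (8 f(x) + 50 n²)`;
* the elementary inequality `log y ≤ y − 1`: with `ρ̄ = m/Z`,
  `ρ log ρ − ρ log ρ̄ ≤ ρ²/ρ̄ − ρ`, and `ρ² = (ρ − a)² + 2aρ − a²` (`a = ρ(p)`); integrating against
  `e^{-f}`, `∫ ρ log ρ e^{-f} − m log ρ̄ ≤ (Z/m) δ (8 ∫ f e^{-f} + 50 n² Z) − (m − aZ)²/m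
  ≤ (δ/c) (8 ∫ f e^{-f} + 50 n² Z)` since `m ≥ cZ`; `δ = cε / (8 ∫ f e^{-f} + 50 n² Z + 1)` does it.

References: D. Bakry, I. Gentil, M. Ledoux, *Analysis and Geometry of Markov Diffusion Operators*
(Springer 2014), proof of Prop. 5.7.1; J. A. Carrillo, L. Ni, Comm. Anal. Geom. 17 (2009), Thm. 1.1;
R. Haslhofer, R. Müller, GAFA 21 (2011), Lemma 2.1; Z.-H. Zhang, Proc. AMS 137 (2009), Thm. 1.3.
-/

noncomputable section

set_option linter.dupNamespace false

open scoped Manifold ContDiff ENNReal NNReal Topology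
open MeasureTheory Set Filter
open Literature.Geometry.Lorentzian Literature.Geometry.Riemannian

namespace Summit.SmoothPoincare4.SmoothPoincare4.Theorems.NoncompactShrinkerGapHeat

open Summit.SmoothPoincare4.SmoothPoincare4.Theorems.NoncompactShrinkerGapCompactSupportLSI

/-- **The real-variable core**: for `r, q > 0`, `r log r − r log q ≤ r² / q − r`
(`log (r/q) ≤ r/q − 1` multiplied by `r`). [folklore] -/
private theorem mul_log_sub_mul_log_le {r q : ℝ} (hr : 0 < r) (hq : 0 < q) :
    r * Real.log r - r * Real.log q ≤ r ^ 2 / q - r := by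
  have h1 : Real.log (r / q) ≤ r / q - 1 := Real.log_le_sub_one_of_pos (div_pos hr hq)
  rw [Real.log_div hr.ne' hq.ne'] at h1
  have h2 := mul_le_mul_of_nonneg_left h1 hr.le
  have h3 : r * (r / q - 1) = r ^ 2 / q - r := by
    field_simp
  linarith [h2, h3]

/-- **Stub `helper_entropyDecay_static`** (line `collapsed-ends-usc`, v13): on a complete connected
normalised gradient shrinker, for `0 < c ≤ C` and `ε > 0` there is `δ > 0` such that every smooth
`ρ` with `c ≤ ρ ≤ C`, `|∇ρ|² ≤ δ` and `∫ ρ e^{-f} = m` satisfies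
`∫ ρ log ρ e^{-f} − m log (m / ∫ e^{-f}) ≤ ε` — small gradient forces small entropy relative to
the mean, with `δ` independent of `ρ` and `m` (Lipschitz bound from the gradient bound, the growth
`d(p, ·)² ≤ 8f + 50n²` of the potential about its minimum point, `log y ≤ y − 1`, and the
integrability of `(1 + f) e^{-f}`). [cite: BakryGentilLedoux2014, proof of Prop. 5.7.1]
[cite: CarrilloNi2009, Thm. 1.1 (i)] [cite: HaslhoferMuller2011, Lemma 2.1] -/
theorem helper_entropyDecay_static : ∀ (n : ℕ) (M : Type*) [TopologicalSpace M] [T2Space M] [SecondCountableTopology M] [ChartedSpace (EuclideanSpace ℝ (Fin n)) M] [IsManifold (𝓡 n) ∞ M] [ConnectedSpace M] [T3Space M] [MeasurableSpace M] [BorelSpace M] (g : PseudoRiemannianMetric (𝓡 n) ∞ (EuclideanSpace ℝ (Fin n)) (TangentSpace (𝓡 n) : M → Type _)) [g.HasLeviCivita] (f : M → ℝ) (hg : g.IsRiemannian), (∀ (x : M) (r : NNReal), IsCompact {y : M | g.edist hg x y ≤ r}) → ContMDiff (𝓡 n) 𝓘(ℝ, ℝ) ∞ f → (∀ (x : M)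 (X Y : TangentSpace (𝓡 n) x), g.ricci x X Y + g.hessian f x X Y = (1 / 2 : ℝ) * g.val x X Y) → (∀ x : M, g.scalarCurvature x + g.gradSq f x = f x) → ∀ (c C ε : ℝ), 0 < c → c ≤ C → 0 < ε → ∃ δ : ℝ, 0 < δ ∧ ∀ (ρ : M → ℝ) (m : ℝ), ContMDiff (𝓡 n) 𝓘(ℝ, ℝ) ∞ ρ → (∀ x, c ≤ ρ x ∧ ρ x ≤ C) → (∀ x, g.gradSq ρ x ≤ δ) → ∫ x, ρ x * Real.exp (-f x) ∂g.riemVolume = m → ∫ x, ρ x * Real.log (ρ x) * Real.exp (-f x) ∂g.riemVolume - m * Real.log (m / ∫ x, Real.exp (-f x) ∂g.riemVolume) ≤ ε := by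
  intro n M _ _ _ _ _ _ _ _ _ g _ f hg hc hf hsol hnorm c C ε hc0 hcC hε
  classical
  /- `R ≥ 0` (Zhang), `|∇f|² ≤ f`, a minimum point, lower growth, properness, integrability -/
  have hk1 : ((1 : ℕ∞) : ℕ∞ω) + 1 ≤ (∞ : ℕ∞ω) := by
    rw [show ((1 : ℕ∞) : ℕ∞ω) + 1 = 2 by norm_num]
    exact WithTop.coe_le_coe.2 le_top
  haveI : CovariantDerivative.ContMDiffCovariantDerivative g.leviCivita 1 :=
    ⟨g.isLocallyContMDiff_leviCivita_holds 1 hk1 univ isOpen_univ⟩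
  haveI : CovariantDerivative.ContMDiffCovariantDerivative g.leviCivita ∞ :=
    ⟨g.isLocallyContMDiff_leviCivita_holds ⊤ (le_of_eq rfl) univ isOpen_univ⟩
  have hS0 : ∀ x, 0 ≤ g.scalarCurvature x := fun x ↦
    Zhang2009.minimumPrinciple_core g hg hc hf hsol
      (fun p ↦ Zhang2009.directionalComparison_core g hg hc hf hsol p) x
  have hgrad : ∀ x, g.gradSq f x ≤ f x := fun x ↦ by linarith [hS0 x, hnorm x]
  have hf0 : ∀ x, 0 ≤ f x := fun x ↦ (g.gradSq_nonneg hg f x).trans (hgrad x)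
  obtain ⟨p, hp⟩ := HaslhoferMuller.exists_forall_potential_le g hg hc hf hgrad hsol
  have hlow : ∀ (x : M) (r : NNReal), (r : ℝ≥0∞) ≤ g.edist hg p x →
      (1 / 4 : ℝ) * (max ((r : ℝ) - 5 * n) 0) ^ 2 ≤ f x := fun x r hr ↦ by
    have h := HaslhoferMuller.potential_lower_of_scalarCurvature_nonneg g hg hc hf hsol hnorm
      hS0 hp x r hr
    rwa [finrank_euclideanSpace_fin] at h
  haveI : Nonempty M := ⟨p⟩
  have hprop : ∀ R : ℝ, IsCompact {x | f x ≤ R} :=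
    isCompact_sublevel_of_growth hg hf.continuous hc hlow
  obtain ⟨hint, hfint⟩ :=
    CarrilloNi2009_shrinkerLSI.integrable_exp_neg_of_proper hg hf hsol hnorm hprop
  set vol := g.riemVolume with hvol
  set Z : ℝ := ∫ x, Real.exp (-f x) ∂vol with hZdef
  set F : ℝ := ∫ x, f x * Real.exp (-f x) ∂vol with hFdef
  have hZpos : 0 < Z := by
    have hA : 0 < (4 * Real.pi) ^ (-(n : ℝ) / 2) := Real.rpow_pos_of_pos (by positivity) _
    exact pos_of_mul_pos_right (CarrilloNi2009_shrinkerLSI.theta_pos hg hint) hA.le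
  have hF0 : 0 ≤ F := integral_nonneg fun x ↦ mul_nonneg (hf0 x) (Real.exp_pos _).le
  -- the second-moment control `d(p, x)² ≤ 8 f(x) + 50 n²`
  set K2 : ℝ := 2 * (5 * (n : ℝ)) ^ 2 with hK2def
  have hK20 : 0 ≤ K2 := by positivity
  have hdist : ∀ x, (g.edist hg p x).toReal ^ 2 ≤ 8 * f x + K2 := fun x ↦
    toReal_edist_sq_le hg (fun r hr ↦ hlow x r hr) (PseudoRiemannianMetric.edist_lt_top hg p x)
  set B : ℝ := 8 * F + K2 * Z with hBdef
  have hB0 : 0 ≤ B := add_nonneg (by linarith) (mul_nonneg hK20 hZpos.le)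
  have hB1 : 0 < B + 1 := by linarith
  refine ⟨c * ε / (B + 1), div_pos (mul_pos hc0 hε) hB1, ?_⟩
  intro ρ m hρ hρb hρg hm
  set δ : ℝ := c * ε / (B + 1) with hδdef
  have hδ0 : 0 < δ := div_pos (mul_pos hc0 hε) hB1
  have hρpos : ∀ x, 0 < ρ x := fun x ↦ hc0.trans_le (hρb x).1
  have hρc : Continuous ρ := hρ.continuous
  /- the Lipschitz bound: `(ρ x − ρ p)² ≤ δ d(p, x)² ≤ δ (8 f x + 50 n²)` -/
  set a : ℝ := ρ p with hadef
  have hlip : ∀ x, (ρ x - a) ^ 2 ≤ δ * (8 * f x + K2) := by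
    intro x
    have hL : 0 < Real.sqrt δ := Real.sqrt_pos.2 hδ0
    have h1 := ofReal_abs_sub_le_of_gradSq_le g hg (f := ρ) (hρ.of_le ENat.LEInfty.out) hL
      (fun y ↦ by rw [Real.sq_sqrt hδ0.le]; exact hρg y) p x
    have hfin : g.edist hg p x ≠ ⊤ := (PseudoRiemannianMetric.edist_lt_top hg p x).ne
    rw [← ENNReal.ofReal_toReal hfin, ← ENNReal.ofReal_mul hL.le,
      ENNReal.ofReal_le_ofReal_iff (by positivity)] at h1
    have h2 : (ρ p - ρ x) ^ 2 ≤ (Real.sqrt δ * (g.edist hg p x).toReal) ^ 2 := by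
      rw [← sq_abs (ρ p - ρ x)]
      exact pow_le_pow_left₀ (abs_nonneg _) h1 2
    rw [mul_pow, Real.sq_sqrt hδ0.le] at h2
    have h3 : δ * (g.edist hg p x).toReal ^ 2 ≤ δ * (8 * f x + K2) :=
      mul_le_mul_of_nonneg_left (hdist x) hδ0.le
    have h4 : (ρ x - a) ^ 2 = (ρ p - ρ x) ^ 2 := by rw [hadef]; ring
    rw [h4]
    exact h2.trans h3
  /- the mean `m/Z ∈ [c, C]·` and integrability of the bounded integrands -/
  have hIρ : Integrable (fun x ↦ ρ x * Real.exp (-f x)) vol :=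
    hint.bdd_mul hρc.aestronglyMeasurable (ae_of_all _ fun x ↦ by
      rw [Real.norm_eq_abs, abs_of_pos (hρpos x)]; exact (hρb x).2)
  set Lb : ℝ := max |Real.log c| |Real.log C| with hLbdef
  have hlogb : ∀ x, |Real.log (ρ x)| ≤ Lb := fun x ↦ by
    refine abs_le.2 ⟨?_, ?_⟩
    · have h1 : Real.log c ≤ Real.log (ρ x) := Real.log_le_log hc0 (hρb x).1
      have h2 : -|Real.log c| ≤ Real.log c := neg_abs_le _
      linarith [le_max_left |Real.log c| |Real.log C|]
    · have h1 : Real.log (ρ x) ≤ Real.log C := Real.log_le_log (hρpos x) (hρb x).2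
      linarith [le_max_right |Real.log c| |Real.log C|, le_abs_self (Real.log C)]
  have hIρlog : Integrable (fun x ↦ ρ x * Real.log (ρ x) * Real.exp (-f x)) vol :=
    hint.bdd_mul (hρc.mul (hρc.log fun x ↦ (hρpos x).ne')).aestronglyMeasurable
      (ae_of_all _ fun x ↦ by
        rw [Real.norm_eq_abs, abs_mul, abs_of_pos (hρpos x)]
        exact mul_le_mul (hρb x).2 (hlogb x) (abs_nonneg _) (hc0.le.trans hcC))
  have hmlow : c * Z ≤ m := by
    rw [← hm, ← integral_const_mul]
    exact integral_mono (hint.const_mul c) hIρ fun x ↦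
      mul_le_mul_of_nonneg_right (hρb x).1 (Real.exp_pos _).le
  have hmpos : 0 < m := (mul_pos hc0 hZpos).trans_le hmlow
  set q : ℝ := m / Z with hqdef
  have hq : 0 < q := div_pos hmpos hZpos
  set w : ℝ := Z / m with hwdef
  have hw0 : 0 ≤ w := (div_pos hZpos hmpos).le
  have hwq : 1 / q = w := by rw [hqdef, hwdef, one_div_div]
  have hwm : w * m = Z := by rw [hwdef]; field_simp
  /- the pointwise inequality and its integral -/
  set α₁ : ℝ := 8 * δ * w with hα₁
  set α₂ : ℝ := (δ * K2 - a ^ 2) * w with hα₂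
  set α₃ : ℝ := 2 * a * w - 1 with hα₃
  have hpt : ∀ x, ρ x * Real.log (ρ x) * Real.exp (-f x) - Real.log q * (ρ x * Real.exp (-f x)) ≤
      α₁ * (f x * Real.exp (-f x)) + α₂ * Real.exp (-f x) + α₃ * (ρ x * Real.exp (-f x)) := by
    intro x
    have h1 := mul_log_sub_mul_log_le (hρpos x) hq
    rw [div_eq_mul_one_div (ρ x ^ 2) q, hwq] at h1
    have h2 : ρ x ^ 2 ≤ δ * (8 * f x + K2) + 2 * a * ρ x - a ^ 2 := by linarith [hlip x]
    have h3 : ρ x ^ 2 * w ≤ (δ * (8 * f x + K2) + 2 * a * ρ x - a ^ 2) * w :=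
      mul_le_mul_of_nonneg_right h2 hw0
    have hcore : ρ x * Real.log (ρ x) - Real.log q * ρ x ≤ α₁ * f x + α₂ + α₃ * ρ x := by
      have h4 : α₁ * f x + α₂ + α₃ * ρ x = (δ * (8 * f x + K2) + 2 * a * ρ x - a ^ 2) * w - ρ x := by
        rw [hα₁, hα₂, hα₃]; ring
      rw [h4]
      linarith
    have h5 := mul_le_mul_of_nonneg_right hcore (Real.exp_pos (-f x)).le
    linarith [h5]
  have hIL : Integrable (fun x ↦ ρ x * Real.log (ρ x) * Real.exp (-f x) -
      Real.log q * (ρ x * Real.exp (-f x))) vol := hIρlog.sub (hIρ.const_mul _)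
  have hIA : Integrable (fun x ↦ α₁ * (f x * Real.exp (-f x)) + α₂ * Real.exp (-f x)) vol :=
    (hfint.const_mul α₁).add (hint.const_mul α₂)
  have hI3 : Integrable (fun x ↦ α₃ * (ρ x * Real.exp (-f x))) vol := hIρ.const_mul α₃
  have hIR : Integrable (fun x ↦ α₁ * (f x * Real.exp (-f x)) + α₂ * Real.exp (-f x) +
      α₃ * (ρ x * Real.exp (-f x))) vol := hIA.add hI3
  have hmono : ∫ x, (ρ x * Real.log (ρ x) * Real.exp (-f x) -
      Real.log q * (ρ x * Real.exp (-f x))) ∂vol ≤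
      ∫ x, (α₁ * (f x * Real.exp (-f x)) + α₂ * Real.exp (-f x) +
        α₃ * (ρ x * Real.exp (-f x))) ∂vol := integral_mono hIL hIR fun x ↦ hpt x
  have hLHS : ∫ x, (ρ x * Real.log (ρ x) * Real.exp (-f x) -
      Real.log q * (ρ x * Real.exp (-f x))) ∂vol =
      (∫ x, ρ x * Real.log (ρ x) * Real.exp (-f x) ∂vol) - Real.log q * m := by
    rw [integral_sub hIρlog (hIρ.const_mul _), integral_const_mul, hm]
  have hRHS : ∫ x, (α₁ * (f x * Real.exp (-f x)) + α₂ * Real.exp (-f x) +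
      α₃ * (ρ x * Real.exp (-f x))) ∂vol = α₁ * F + α₂ * Z + α₃ * m := by
    rw [integral_add hIA hI3, integral_add (hfint.const_mul α₁) (hint.const_mul α₂),
      integral_const_mul, integral_const_mul, integral_const_mul, hm]
  rw [hLHS, hRHS] at hmono
  /- bookkeeping: `α₁ F + α₂ Z + α₃ m = δ w B − (aZ − m)²/m ≤ δ B / c ≤ ε` -/
  have hneg : 0 ≤ a ^ 2 * w * Z - 2 * a * w * m + m := by
    have : a ^ 2 * w * Z - 2 * a * w * m + m = (a * Z - m) ^ 2 / m := by
      rw [hwdef]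
      field_simp
      ring
    rw [this]
    positivity
  have hmain : δ * w * B ≤ ε := by
    have h1 : δ * (B + 1) = c * ε := by rw [hδdef]; field_simp
    have h3 : δ * w * B * (m * (B + 1)) = ε * ((c * Z) * B) := by
      calc δ * w * B * (m * (B + 1)) = (δ * (B + 1)) * (w * m) * B := by ring
        _ = ε * ((c * Z) * B) := by rw [h1, hwm]; ring
    have h4 : ε * ((c * Z) * B) ≤ ε * (m * (B + 1)) := by
      refine mul_le_mul_of_nonneg_left ?_ hε.le
      linarith [mul_nonneg (sub_nonneg.2 hmlow) hB0, hmpos.le]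
    have h5 : 0 < m * (B + 1) := mul_pos hmpos hB1
    exact le_of_mul_le_mul_right (by rw [h3]; linarith [h4]) h5
  have hsum : α₁ * F + α₂ * Z + α₃ * m = δ * w * B - (a ^ 2 * w * Z - 2 * a * w * m + m) := by
    rw [hα₁, hα₂, hα₃, hBdef]; ring
  have hfinal : (∫ x, ρ x * Real.log (ρ x) * Real.exp (-f x) ∂vol) - Real.log q * m ≤ ε := by
    linarith [hmono, hsum, hneg, hmain]
  linarith [hfinal, mul_comm m (Real.log q)]

end Summit.SmoothPoincare4.SmoothPoincare4.Theorems.NoncompactShrinkerGapHeat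

end
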